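import Summits.BirchSwinnertonDyer.BirchSwinnertonDyer.Theorems.ThetaPartnerAtTwoSignedControlAtTwoPlusLayerTwo
import Summits.BirchSwinnertonDyer.Rank1Residual.Additive.PadicClosureCyclotomicGalois
import HarnessLib

/-!
# The `ℤ₂`-LAYERS AT `2` of the cyclotomic `ℤ₂`-extension, II (the model `ℚ_[2]`, layer points, layer traces):
# `Gal(ℚ̄₂/ℚ_{2,n}) = Stab ζ_{2^{n+2}} ⊔ Stab ζ_{2^{n+2}}·σ₀` in the `zeta`/`stab` currency of `PadicCyclotomicTower`, the layer points
# `E(ℚ_n·E)` as `⟨Stab ζ', σ₀⟩`-fixed points (the `Δ`-trace `c + σ₀c` lands in the layer), and the layer traces `Tr_{n/m}` as the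
# `μ`-tower trace sums over `Stab ζ_{2^{m+2}} / Stab ζ_{2^{n+2}}`; local layer degrees `[ℚ_{2,n}·ℚ₂ : ℚ_{2,m}·ℚ₂] = 2^{n−m}`
# (K4 `SignedControlAtTwo`, stmt-BirchSwinnertonDyer-20309, line `eulerchar` v6, typing prerequisite of the stub HONDA⁺@2)

Route `ThetaPartnerAtTwo` (TP2; crux shared with `ResidualThetaTransportAtTwo`), crux K4, line `eulerchar` v6 (lead
`prover-bsd-wall-tp2-p3` g2); seat `prover-bsd-wall-tp2-p3-w2` (width seat 2/3, g2). Sequel of `…PlusLayerTwo` (the Galois groups: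
`Gal(Ē/ℚ_n·E) = {τ : τζ' = ζ'^{±1}}` for every model `E`, embedding `ι` and primitive `2^{n+2}`-th root `ζ'`).

WHY. The stub `stub_plusHondaSystemTwo` (HONDA⁺@2) wants points `d_m ∈ localLayerPointsOfEmb κ ι W m` with
`localTraceOfEmb κ ι W (m+1) (m+2) (d (m+2)) = −d m`; the construction (lead's memo LAGPLUS-AT-2-CONSTRUCTION, K3 lead's
`…SignedKatoUpToAtTwoLocalTwoRealTrace`) delivers `Δ`-traces `e_n = c_{n+2} + σ₀c_{n+2}` of `μ`-tower points with relations written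
as sums over `PadicCyclotomicTower.stab 2 m ⧸ stab 2 (m+1)`. This file converts one currency into the other.

WHAT (THEOREMS ONLY; `κ : ZpExtension ℚ 2` cyclotomic, `W/ℚ` any Weierstrass curve):
* §4 (model `ℚ_[2]`, `ζ' = PadicCyclotomicTower.zeta 2 (n+2)`, any `ι : ℚ̄ → ℚ̄₂`) `mem_localLayerSubgroupOfEmb_two_iff_zeta`,
  `…_iff_apply_u` (the form of `PlusTower.apply_u_eq_iff`), `localLayerSubgroupOfEmb_two_eq_stabilizer_u`,
  `stab_le_localLayerSubgroupOfEmb_two` (`Stab ζ_{2^{n+2}} ≤ Gal(ℚ̄₂/ℚ_{2,n})`), `smul_zeta_eq_inv_of_mem_of_not_mem_stab` (the other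
  coset inverts `ζ`), `stab_inf_localLayerSubgroupOfEmb_two` (`Stab ζ_{2^{m+2}} ⊓ Gal(ℚ̄₂/ℚ_{2,n}) = Stab ζ_{2^{n+2}}`, `m ≤ n`),
  `exists_inverter_mem_localLayerSubgroupOfEmb_two` (an inverter `σ₀` of `ζ_{2^{n+2}}` in `Gal(ℚ̄₂/ℚ_{2,n})`, the generator of `Δ`).
* §5 (any `ℚ`-field `E`, any `ι`, `ζ' ∈ Ē` a primitive `2^{n+2}`-th root, `σ₀ζ' = ζ'⁻¹`) `mem_localLayerPointsOfEmb_two_iff`: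
  **`P ∈ E(ℚ_n·E) ⟺ P` is fixed by `Stab_{Γ_E} ζ'` and by `σ₀`**; `add_smul_mem_localLayerPointsOfEmb_two`: **the `Δ`-trace
  `c + σ₀c` of a `Stab ζ'`-fixed point lies in `E(ℚ_n·E)`** (`σ₀² ∈ Stab ζ' ⊴ Γ_E`) — the shape of the memo's
  `e_n = Tr_{ℚ₂(ζ_{2^{n+2}})/ℚ_{2,n}} c_{n+2}`; `…_stab` versions at the model `ℚ_[2]`.
* §6 (model `ℚ_[2]`, any `ι`, `m ≤ n`) `bijective_quotientMap_stab_localLayerSubgroupOfEmb_two`: the map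
  `Stab ζ_{2^{m+2}} / Stab ζ_{2^{n+2}} → Gal(ℚ̄₂/ℚ_{2,m}) / Gal(ℚ̄₂/ℚ_{2,n})` is a bijection; `localTraceOfEmb_two_eq_sum_stab`:
  **`Tr_{n/m} P = ∑_{q ∈ Stab ζ_{2^{m+2}} / Stab ζ_{2^{n+2}}} q̃ • P` for `P ∈ E(ℚ_{2,n}·ℚ₂)`** (the sums of `…LocalTwoRealTrace`);
  `index_subgroupOf_localLayerSubgroupOfEmb_two` (`= 2^{n−m}`), `index_localLayerSubgroupOfEmb_two` (`[Γ_{ℚ₂} : Gal(ℚ̄₂/ℚ_{2,n})] = 2ⁿ`).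

HONEST FRAMING: THEOREMS ONLY (no definition, no named fact, no instance, no `sorry`), route-independent (no `Theses`
import); Galois bookkeeping on the tree's local points, nothing about any Selmer group; closes no item; BSD is not proved by
any of this.

References: [Kobayashi2003] S. Kobayashi, Invent. Math. 152 (2003), Def. 1.1 (`E(F_{n,p})`, `Tr_{n/m}`), §8.4, Lemma 8.9;
[Washington1997] L. C. Washington, *Introduction to Cyclotomic Fields*, 2nd ed., §13.1; [Tate1967] §3.1; [NeukirchANT1999] Ch. IV §1.
-/

set_option autoImplicit false
-- the Theorems namespace of this sub repeats the summit name by design (D-0017 nested layout)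
set_option linter.dupNamespace false

noncomputable section

open scoped Classical

namespace Summit.BirchSwinnertonDyer.BirchSwinnertonDyer.Theorems.SignedEC.PlusLayer

open Field Literature.NumberTheory.EllipticCurves Literature.NumberTheory.GaloisRepresentations
  Literature.NumberTheory.EllipticCurves.ZpExtension Literature.NumberTheory.EllipticCurves.Kobayashi2003

/-! ## §4 The model `E = ℚ_[2]`: `Gal(ℚ̄₂/ℚ_{2,n}) = {τ : τ ζ_{2^{n+2}} = ζ_{2^{n+2}}^{±1}} ⊇ Stab ζ_{2^{n+2}}` in the currency of
`PadicCyclotomicTower` -/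

section Padic

open Summit.BirchSwinnertonDyer.Rank1Residual.Additive.PadicCyclotomicTower

variable {κ : ZpExtension ℚ 2} (ι : AlgebraicClosure ℚ →ₐ[ℚ] PadicAlgCl 2)

/-- **`Gal(ℚ̄₂/ℚ_{2,n}) = {τ : τζ_{2^{n+2}} = ζ_{2^{n+2}} ∨ τζ_{2^{n+2}} = ζ_{2^{n+2}}⁻¹}`** for the compatible roots
`ζ_{2^m} = PadicCyclotomicTower.zeta 2 m` of the O10 local series, any `ι : ℚ̄ → ℚ̄₂`, any cyclotomic `κ`.
[cite: Washington1997, §13.1] [cite: Kobayashi2003, Def. 1.1, §8.4] -/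
theorem mem_localLayerSubgroupOfEmb_two_iff_zeta (hκ : κ.IsCyclotomic) (n : ℕ) (τ : absoluteGaloisGroup ℚ_[2]) :
    τ ∈ localLayerSubgroupOfEmb κ ι n ↔
      τ • zeta 2 (n + 2) = zeta 2 (n + 2) ∨ τ • zeta 2 (n + 2) = (zeta 2 (n + 2))⁻¹ :=
  mem_localLayerSubgroupOfEmb_two_iff ι hκ (isPrimitiveRoot_zeta 2 (n + 2)) τ

/-- The same through the underlying automorphism of `ℚ̄₂` (the form of `PlusTower.apply_u_eq_iff`):
`τ ∈ Gal(ℚ̄₂/ℚ_{2,n}) ⟺ τ(u_{n+2}) = u_{n+2}`, `u_m = ζ_{2^m} + ζ_{2^m}⁻¹`. [cite: Washington1997, §13.1 and Prop. 2.16] -/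
theorem mem_localLayerSubgroupOfEmb_two_iff_apply_u (hκ : κ.IsCyclotomic) (n : ℕ) (τ : absoluteGaloisGroup ℚ_[2]) :
    τ ∈ localLayerSubgroupOfEmb κ ι n ↔
      absoluteGaloisGroup.toAlgEquiv ℚ_[2] τ (zeta 2 (n + 2) + (zeta 2 (n + 2))⁻¹) =
        zeta 2 (n + 2) + (zeta 2 (n + 2))⁻¹ :=
  mem_localLayerSubgroupOfEmb_two_iff_smul_add_inv ι hκ (isPrimitiveRoot_zeta 2 (n + 2)) τ

/-- **`Gal(ℚ̄₂/ℚ_{2,n}) = Stab_{Γ_{ℚ₂}}(ζ_{2^{n+2}} + ζ_{2^{n+2}}⁻¹)`**: `ℚ_{2,n} = ℚ₂(ζ_{2^{n+2}})⁺`. [cite: Washington1997, §13.1] -/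
theorem localLayerSubgroupOfEmb_two_eq_stabilizer_u (hκ : κ.IsCyclotomic) (n : ℕ) :
    localLayerSubgroupOfEmb κ ι n =
      MulAction.stabilizer (absoluteGaloisGroup ℚ_[2]) (zeta 2 (n + 2) + (zeta 2 (n + 2))⁻¹) :=
  localLayerSubgroupOfEmb_two_eq_stabilizer ι hκ (isPrimitiveRoot_zeta 2 (n + 2))

/-- **`Stab ζ_{2^{n+2}} ≤ Gal(ℚ̄₂/ℚ_{2,n})`** (`ℚ₂(ζ_{2^{n+2}}) ⊇ ℚ_{2,n}`, quadratic). [cite: Washington1997, §13.1] -/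
theorem stab_le_localLayerSubgroupOfEmb_two (hκ : κ.IsCyclotomic) (n : ℕ) :
    stab 2 (n + 2) ≤ localLayerSubgroupOfEmb κ ι n :=
  fun τ hτ ↦ (mem_localLayerSubgroupOfEmb_two_iff_zeta ι hκ n τ).mpr (Or.inl ((mem_stab_iff τ).mp hτ))

/-- The non-trivial coset of `Stab ζ_{2^{n+2}}` in `Gal(ℚ̄₂/ℚ_{2,n})` inverts `ζ_{2^{n+2}}`. [cite: Washington1997, §13.1] -/
theorem smul_zeta_eq_inv_of_mem_of_not_mem_stab (hκ : κ.IsCyclotomic) {n : ℕ} {τ : absoluteGaloisGroup ℚ_[2]}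
    (hτ : τ ∈ localLayerSubgroupOfEmb κ ι n) (hτ' : τ ∉ stab 2 (n + 2)) :
    τ • zeta 2 (n + 2) = (zeta 2 (n + 2))⁻¹ :=
  ((mem_localLayerSubgroupOfEmb_two_iff_zeta ι hκ n τ).mp hτ).resolve_left fun h ↦ hτ' ((mem_stab_iff τ).mpr h)

/-- **`Stab ζ_{2^{m+2}} ⊓ Gal(ℚ̄₂/ℚ_{2,n}) = Stab ζ_{2^{n+2}}`** for `m ≤ n` (`ℚ₂(ζ_{2^{m+2}})·ℚ_{2,n} = ℚ₂(ζ_{2^{n+2}})`).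
[cite: Washington1997, §13.1] -/
theorem stab_inf_localLayerSubgroupOfEmb_two (hκ : κ.IsCyclotomic) {m n : ℕ} (hmn : m ≤ n) :
    stab 2 (m + 2) ⊓ localLayerSubgroupOfEmb κ ι n = stab 2 (n + 2) := by
  refine le_antisymm ?_ (le_inf (stab_antitone 2 (by omega)) (stab_le_localLayerSubgroupOfEmb_two ι hκ n))
  intro τ hτ
  obtain ⟨hτm, hτn⟩ := Subgroup.mem_inf.mp hτ
  rw [mem_stab_iff] at hτm ⊢
  refine smul_eq_self_of_smul_pow_eq_self_of_mem ι hκ (isPrimitiveRoot_zeta 2 (n + 2)) hmn ?_ hτn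
  obtain ⟨j, rfl⟩ := Nat.exists_eq_add_of_le hmn
  rw [show m + j - m = j from Nat.add_sub_cancel_left m j, show m + j + 2 = (m + 2) + j by ring, zeta_add_pow]
  exact hτm

/-- An automorphism of `ℚ̄₂/ℚ₂` inverting `ζ_{2^m}` (`m ≥ 1`; re-derived from `exists_algEquiv_apply_zeta_eq_pow` to keep this file's
imports light — the same statement as `SignedKatoOffTwo.LocalTwo.exists_smul_zeta_eq_inv`). [folklore] -/
private theorem exists_smul_zeta_eq_inv' {m : ℕ} (hm : 1 ≤ m) :
    ∃ σ : absoluteGaloisGroup ℚ_[2], σ • zeta 2 m = (zeta 2 m)⁻¹ := by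
  have h1 : 1 ≤ 2 ^ m := Nat.one_le_two_pow
  have hcop : (2 ^ m - 1).Coprime 2 := by
    rw [Nat.coprime_two_right]
    obtain ⟨m', rfl⟩ := Nat.exists_eq_add_of_le' hm
    refine ⟨2 ^ m' - 1, ?_⟩
    have : 1 ≤ 2 ^ m' := Nat.one_le_two_pow
    rw [pow_succ]; omega
  obtain ⟨σ', hσ'⟩ := exists_algEquiv_apply_zeta_eq_pow 2 hm hcop
  refine ⟨(absoluteGaloisGroup.toAlgEquiv ℚ_[2]).symm σ', ?_⟩
  rw [absoluteGaloisGroup.toAlgEquiv_symm_apply, hσ']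
  have hζ : zeta 2 m ^ (2 ^ m - 1) * zeta 2 m = 1 := by
    rw [pow_sub_one_mul (by positivity), (isPrimitiveRoot_zeta 2 m).pow_eq_one]
  exact eq_inv_of_mul_eq_one_left hζ

/-- **There is an automorphism of `ℚ̄₂/ℚ₂` inverting `ζ_{2^{n+2}}`; it lies in `Gal(ℚ̄₂/ℚ_{2,n})` and generates it together with
`Stab ζ_{2^{n+2}}`** (existence half; the generator of `Gal(ℚ₂(ζ_{2^{n+2}})/ℚ_{2,n}) = Δ`). [cite: Washington1997, §13.1] -/
theorem exists_inverter_mem_localLayerSubgroupOfEmb_two (hκ : κ.IsCyclotomic) (n : ℕ) :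
    ∃ σ₀ ∈ localLayerSubgroupOfEmb κ ι n, σ₀ • zeta 2 (n + 2) = (zeta 2 (n + 2))⁻¹ := by
  obtain ⟨σ₀, hσ₀⟩ := exists_smul_zeta_eq_inv' (m := n + 2) (by omega)
  exact ⟨σ₀, (mem_localLayerSubgroupOfEmb_two_iff_zeta ι hκ n σ₀).mpr (Or.inr hσ₀), hσ₀⟩

end Padic

/-! ## §5 The layer points `E(ℚ_n·E)` as `⟨Stab ζ', σ₀⟩`-fixed points; the `Δ`-trace lands in the layer -/

section Points

variable {κ : ZpExtension ℚ 2} {n : ℕ} {E : Type} [Field E] [Algebra ℚ E]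
  (ι : AlgebraicClosure ℚ →ₐ[ℚ] AlgebraicClosure E) (W : WeierstrassCurve ℚ)

/-- **`P ∈ E(ℚ_n·E) ⟺ P` is fixed by `Stab_{Γ_E}(ζ')` and by ONE inverter `σ₀` of `ζ'`** (`ζ'` a primitive `2^{n+2}`-th root of
unity of `Ē`): `Gal(Ē/ℚ_n·E) = Stab ζ' ∪ Stab ζ'·σ₀`. The `Δ`-descent shape of the `ℤ₂`-layer points. [cite: Kobayashi2003, Def. 1.1]
[cite: Washington1997, §13.1] -/
theorem mem_localLayerPointsOfEmb_two_iff (hκ : κ.IsCyclotomic) {ζ' : AlgebraicClosure E}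
    (hζ' : IsPrimitiveRoot ζ' (2 ^ (n + 2))) {σ₀ : absoluteGaloisGroup E} (hσ₀ : σ₀ • ζ' = ζ'⁻¹) (P : localPoints W E) :
    P ∈ localLayerPointsOfEmb κ ι W n ↔
      (∀ τ : absoluteGaloisGroup E, τ • ζ' = ζ' → τ • P = P) ∧ σ₀ • P = P := by
  rw [mem_localLayerPointsOfEmb_iff]
  constructor
  · intro h
    exact ⟨fun τ hτ ↦ h τ ((mem_localLayerSubgroupOfEmb_two_iff ι hκ hζ' τ).mpr (Or.inl hτ)),
      h σ₀ ((mem_localLayerSubgroupOfEmb_two_iff ι hκ hζ' σ₀).mpr (Or.inr hσ₀))⟩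
  · rintro ⟨hfix, h0⟩ τ hτ
    rcases (mem_localLayerSubgroupOfEmb_two_iff ι hκ hζ' τ).mp hτ with h | h
    · exact hfix τ h
    · have hinv : σ₀⁻¹ • ζ' = ζ'⁻¹ := by
        rw [inv_smul_eq_iff, smul_inv'', hσ₀, inv_inv]
      have h1 : (τ * σ₀⁻¹) • ζ' = ζ' := by rw [mul_smul, hinv, smul_inv'', h, inv_inv]
      calc τ • P = (τ * σ₀⁻¹) • (σ₀ • P) := by rw [mul_smul, inv_smul_smul]
        _ = (τ * σ₀⁻¹) • P := by rw [h0]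
        _ = P := hfix _ h1

/-- **The `Δ`-trace lands in the `ℤ₂`-layer**: for `c ∈ E(Ē)` fixed by `Stab_{Γ_E}(ζ')` (`ζ'` a primitive `2^{n+2}`-th root, i.e.
`c ∈ E(E(ζ_{2^{n+2}}))`) and an inverter `σ₀` of `ζ'`, the point `c + σ₀c` lies in `E(ℚ_n·E)` — the shape of the memo's
`e_n = Tr_{ℚ₂(ζ_{2^{n+2}})/ℚ_{2,n}} c_{n+2}` (uses `σ₀² ∈ Stab ζ'` and `Stab ζ' ⊴ Γ_E`). [cite: Kobayashi2003, §8.4] [cite: Washington1997, §13.1] -/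
theorem add_smul_mem_localLayerPointsOfEmb_two (hκ : κ.IsCyclotomic) {ζ' : AlgebraicClosure E}
    (hζ' : IsPrimitiveRoot ζ' (2 ^ (n + 2))) {σ₀ : absoluteGaloisGroup E} (hσ₀ : σ₀ • ζ' = ζ'⁻¹) {c : localPoints W E}
    (hc : ∀ τ : absoluteGaloisGroup E, τ • ζ' = ζ' → τ • c = c) :
    c + σ₀ • c ∈ localLayerPointsOfEmb κ ι W n := by
  rw [mem_localLayerPointsOfEmb_two_iff ι W hκ hζ' hσ₀]
  have hstab : ∀ τ : absoluteGaloisGroup E, τ • ζ' = ζ' → τ • (σ₀ • c) = σ₀ • c := by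
    intro τ hτ
    have h1 : (σ₀⁻¹ * τ * σ₀) • ζ' = ζ' := by
      rw [mul_assoc, mul_smul, inv_smul_eq_iff, mul_smul, hσ₀, smul_inv'', hτ]
    calc τ • σ₀ • c = σ₀ • ((σ₀⁻¹ * τ * σ₀) • c) := by rw [mul_smul, mul_smul, smul_inv_smul]
      _ = σ₀ • c := by rw [hc _ h1]
  have hsq : σ₀ • (σ₀ • c) = c := by
    have h1 : (σ₀ * σ₀) • ζ' = ζ' := by rw [mul_smul, hσ₀, smul_inv'', hσ₀, inv_inv]
    rw [← mul_smul, hc _ h1]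
  refine ⟨fun τ hτ ↦ ?_, ?_⟩
  · rw [smul_add, hc τ hτ, hstab τ hτ]
  · rw [smul_add, hsq, add_comm]

open Summit.BirchSwinnertonDyer.Rank1Residual.Additive.PadicCyclotomicTower

variable (ι₂ : AlgebraicClosure ℚ →ₐ[ℚ] PadicAlgCl 2)

/-- **`E(ℚ_{2,n}·ℚ₂)`-membership at the model `ℚ_[2]`**: `P ∈ E(ℚ_{2,n}·ℚ₂) ⟺ P` is fixed by `Stab ζ_{2^{n+2}}` (i.e.
`P ∈ E(ℚ₂(ζ_{2^{n+2}}))`) and by one inverter `σ₀` of `ζ_{2^{n+2}}`. [cite: Kobayashi2003, Def. 1.1, §8.4] [cite: Washington1997, §13.1] -/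
theorem mem_localLayerPointsOfEmb_two_iff_stab (hκ : κ.IsCyclotomic) {σ₀ : absoluteGaloisGroup ℚ_[2]}
    (hσ₀ : σ₀ • zeta 2 (n + 2) = (zeta 2 (n + 2))⁻¹) (P : localPoints W ℚ_[2]) :
    P ∈ localLayerPointsOfEmb κ ι₂ W n ↔ (∀ τ ∈ stab 2 (n + 2), τ • P = P) ∧ σ₀ • P = P := by
  rw [mem_localLayerPointsOfEmb_two_iff ι₂ W hκ (isPrimitiveRoot_zeta 2 (n + 2)) hσ₀]
  simp only [mem_stab_iff]

/-- **The `Δ`-trace `c + σ₀c` of a point over `ℚ₂(ζ_{2^{n+2}})` lies in `E(ℚ_{2,n}·ℚ₂)`** (model `ℚ_[2]`, `Stab` currency).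
[cite: Kobayashi2003, §8.4] [cite: Washington1997, §13.1] -/
theorem add_smul_mem_localLayerPointsOfEmb_two_stab (hκ : κ.IsCyclotomic) {σ₀ : absoluteGaloisGroup ℚ_[2]}
    (hσ₀ : σ₀ • zeta 2 (n + 2) = (zeta 2 (n + 2))⁻¹) {c : localPoints W ℚ_[2]} (hc : ∀ τ ∈ stab 2 (n + 2), τ • c = c) :
    c + σ₀ • c ∈ localLayerPointsOfEmb κ ι₂ W n :=
  add_smul_mem_localLayerPointsOfEmb_two ι₂ W hκ (isPrimitiveRoot_zeta 2 (n + 2)) hσ₀ fun τ hτ ↦ hc τ ((mem_stab_iff τ).mpr hτ)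

end Points

/-! ## §6 The layer traces `Tr_{n/m}` at the model `ℚ_[2]` are the `μ`-tower trace sums over `Stab ζ_{2^{m+2}} / Stab ζ_{2^{n+2}}` -/

section Trace

open Summit.BirchSwinnertonDyer.Rank1Residual.Additive.PadicCyclotomicTower

variable {κ : ZpExtension ℚ 2} (ι : AlgebraicClosure ℚ →ₐ[ℚ] PadicAlgCl 2) (W : WeierstrassCurve ℚ)

/-- **The comparison of quotients `Stab ζ_{2^{m+2}} / Stab ζ_{2^{n+2}} → Gal(ℚ̄₂/ℚ_{2,m}) / Gal(ℚ̄₂/ℚ_{2,n})` induced by the inclusion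
is a bijection** (`m ≤ n`): injective by `Stab ζ_{2^{m+2}} ∩ Gal(ℚ̄₂/ℚ_{2,n}) = Stab ζ_{2^{n+2}}`, surjective because an inverter `σ₀`
of `ζ_{2^{n+2}}` lies in `Gal(ℚ̄₂/ℚ_{2,n})` and moves the inverting coset of `Stab ζ_{2^{m+2}}` back into `Stab ζ_{2^{m+2}}` —
`Gal(ℚ₂(ζ_{2^{n+2}})/ℚ₂(ζ_{2^{m+2}})) ≅ Gal(ℚ_{2,n}/ℚ_{2,m})` by restriction. [cite: Washington1997, §13.1] -/
theorem bijective_quotientMap_stab_localLayerSubgroupOfEmb_two (hκ : κ.IsCyclotomic) {m n : ℕ} (hmn : m ≤ n) :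
    Function.Bijective
      (Quotient.map' (Subgroup.inclusion (stab_le_localLayerSubgroupOfEmb_two ι hκ m))
        (fun a b hab ↦ by
          rw [QuotientGroup.leftRel_apply, Subgroup.mem_subgroupOf] at hab ⊢
          exact stab_le_localLayerSubgroupOfEmb_two ι hκ n hab) :
        stab 2 (m + 2) ⧸ (stab 2 (n + 2)).subgroupOf (stab 2 (m + 2)) →
          localLayerSubgroupOfEmb κ ι m ⧸ (localLayerSubgroupOfEmb κ ι n).subgroupOf (localLayerSubgroupOfEmb κ ι m)) := by
  constructor
  · intro q q' h
    induction q using Quotient.inductionOn' with | h a => ?_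
    induction q' using Quotient.inductionOn' with | h b => ?_
    rw [Quotient.map'_mk'', Quotient.map'_mk''] at h
    change (QuotientGroup.mk _ : _ ⧸ _) = QuotientGroup.mk _ at h
    change (QuotientGroup.mk a : _ ⧸ _) = QuotientGroup.mk b
    rw [QuotientGroup.eq, Subgroup.mem_subgroupOf] at h ⊢
    have hmem : ((a⁻¹ * b : stab 2 (m + 2)) : absoluteGaloisGroup ℚ_[2]) ∈
        stab 2 (m + 2) ⊓ localLayerSubgroupOfEmb κ ι n := ⟨(a⁻¹ * b).2, h⟩
    rwa [stab_inf_localLayerSubgroupOfEmb_two ι hκ hmn] at hmem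
  · intro q
    induction q using Quotient.inductionOn' with | h τ => ?_
    obtain ⟨σ₀, hσ₀n, hσ₀⟩ := exists_inverter_mem_localLayerSubgroupOfEmb_two ι hκ n
    by_cases hτ : (τ : absoluteGaloisGroup ℚ_[2]) ∈ stab 2 (m + 2)
    · exact ⟨Quotient.mk'' ⟨τ, hτ⟩, by rw [Quotient.map'_mk'']; rfl⟩
    · -- `τ` inverts `ζ_{2^{m+2}}`, and so does `σ₀`; `τσ₀ ∈ Stab ζ_{2^{m+2}}` represents the same coset
      have hτinv : (τ : absoluteGaloisGroup ℚ_[2]) • zeta 2 (m + 2) = (zeta 2 (m + 2))⁻¹ :=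
        smul_zeta_eq_inv_of_mem_of_not_mem_stab ι hκ τ.2 hτ
      have hσ₀m : σ₀ • zeta 2 (m + 2) = (zeta 2 (m + 2))⁻¹ := by
        obtain ⟨j, rfl⟩ := Nat.exists_eq_add_of_le hmn
        rw [show m + j + 2 = (m + 2) + j by ring] at hσ₀
        rw [← zeta_add_pow 2 (m + 2) j, smul_pow', hσ₀, inv_pow]
      have hσ₀m' : σ₀ ∈ localLayerSubgroupOfEmb κ ι m := localLayerSubgroupOfEmb_antitone κ ι hmn hσ₀n
      have hprod : (τ : absoluteGaloisGroup ℚ_[2]) * σ₀ ∈ stab 2 (m + 2) := by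
        rw [mem_stab_iff, mul_smul, hσ₀m, smul_inv'', hτinv, inv_inv]
      refine ⟨Quotient.mk'' ⟨(τ : absoluteGaloisGroup ℚ_[2]) * σ₀, hprod⟩, ?_⟩
      rw [Quotient.map'_mk'']
      change (QuotientGroup.mk _ : _ ⧸ _) = QuotientGroup.mk τ
      rw [QuotientGroup.eq, Subgroup.mem_subgroupOf]
      change ((⟨(τ : absoluteGaloisGroup ℚ_[2]) * σ₀, mul_mem τ.2 hσ₀m'⟩ : localLayerSubgroupOfEmb κ ι m)⁻¹ * τ :
          absoluteGaloisGroup ℚ_[2]) ∈ localLayerSubgroupOfEmb κ ι n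
      simp only [Subgroup.coe_inv, mul_inv_rev, mul_assoc, inv_mul_cancel, mul_one]
      exact inv_mem hσ₀n

/-- **`Tr_{n/m} P = ∑_{q ∈ Stab ζ_{2^{m+2}} / Stab ζ_{2^{n+2}}} q̃ • P` for `P ∈ E(ℚ_{2,n}·ℚ₂)`, `m ≤ n`** (model `ℚ_[2]`, any `ι`,
any cyclotomic `κ`): Kobayashi's layer trace `localTraceOfEmb κ ι W m n` in the currency of the `μ`-tower trace sums of the
O10 series / `…LocalTwoRealTrace` (coset representatives `q.out`; independent of representatives on `E(ℚ_{2,n}·ℚ₂)`).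
[cite: Kobayashi2003, Def. 1.1, Lemma 8.9] [cite: Washington1997, §13.1] -/
theorem localTraceOfEmb_two_eq_sum_stab (hκ : κ.IsCyclotomic) {m n : ℕ} (hmn : m ≤ n)
    [Fintype (stab 2 (m + 2) ⧸ (stab 2 (n + 2)).subgroupOf (stab 2 (m + 2)))]
    {P : localPoints W ℚ_[2]} (hP : P ∈ localLayerPointsOfEmb κ ι W n) :
    localTraceOfEmb κ ι W m n P =
      ∑ q : stab 2 (m + 2) ⧸ (stab 2 (n + 2)).subgroupOf (stab 2 (m + 2)),
        ((q.out : stab 2 (m + 2)) : absoluteGaloisGroup ℚ_[2]) • P := by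
  classical
  haveI : Fintype (localLayerSubgroupOfEmb κ ι m ⧸
      (localLayerSubgroupOfEmb κ ι n).subgroupOf (localLayerSubgroupOfEmb κ ι m)) := Fintype.ofFinite _
  set φ := Equiv.ofBijective _ (bijective_quotientMap_stab_localLayerSubgroupOfEmb_two ι hκ hmn) with hφ
  -- the section `q ↦ incl ((φ⁻¹ q).out)` of `Gal(ℚ̄₂/ℚ_{2,m}) → Gal(ℚ̄₂/ℚ_{2,m})/Gal(ℚ̄₂/ℚ_{2,n})`
  rw [localTraceOfEmb_apply_eq_sum_of_mem κ ι W m n hP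
    (fun q ↦ Subgroup.inclusion (stab_le_localLayerSubgroupOfEmb_two ι hκ m) (φ.symm q).out) ?_]
  · exact Fintype.sum_equiv φ.symm _ _ fun q ↦ rfl
  · intro q
    conv_rhs => rw [← φ.apply_symm_apply q]
    rw [hφ, Equiv.ofBijective_apply]
    conv_rhs => rw [← Quotient.out_eq' (φ.symm q)]
    rfl

/-- **`[Gal(ℚ̄₂/ℚ_{2,m}) : Gal(ℚ̄₂/ℚ_{2,n})] = 2^{n−m}`** (`m ≤ n`; model `ℚ_[2]`, any `ι`, any cyclotomic `κ`): the local layer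
degree `[ℚ_{2,n}·ℚ₂ : ℚ_{2,m}·ℚ₂]`, from the bijection with `Stab ζ_{2^{m+2}} / Stab ζ_{2^{n+2}}` and `[Γ : Stab ζ_{2^k}] = φ(2^k)`.
[cite: Washington1997, §13.1] [cite: Kobayashi2003, §2 p. 4] -/
theorem index_subgroupOf_localLayerSubgroupOfEmb_two (hκ : κ.IsCyclotomic) {m n : ℕ} (hmn : m ≤ n) :
    ((localLayerSubgroupOfEmb κ ι n).subgroupOf (localLayerSubgroupOfEmb κ ι m)).index = 2 ^ (n - m) := by
  have hcard : Nat.card (stab 2 (m + 2) ⧸ (stab 2 (n + 2)).subgroupOf (stab 2 (m + 2))) =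
      Nat.card (localLayerSubgroupOfEmb κ ι m ⧸
        (localLayerSubgroupOfEmb κ ι n).subgroupOf (localLayerSubgroupOfEmb κ ι m)) :=
    Nat.card_congr (Equiv.ofBijective _ (bijective_quotientMap_stab_localLayerSubgroupOfEmb_two ι hκ hmn))
  rw [Subgroup.index, ← hcard, ← Subgroup.index]
  have hrel : ((stab 2 (n + 2)).subgroupOf (stab 2 (m + 2))).index * (stab 2 (m + 2)).index = (stab 2 (n + 2)).index :=
    Subgroup.relIndex_mul_index (stab_antitone 2 (by omega : m + 2 ≤ n + 2))
  rw [index_stab' 2 (m + 2), index_stab' 2 (n + 2), Nat.totient_prime_pow_succ Nat.prime_two,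
    Nat.totient_prime_pow_succ Nat.prime_two] at hrel
  obtain ⟨j, rfl⟩ := Nat.exists_eq_add_of_le hmn
  rw [Nat.add_sub_cancel_left]
  have hrel' : ((stab 2 (m + j + 2)).subgroupOf (stab 2 (m + 2))).index * 2 ^ (m + 1) = 2 ^ j * 2 ^ (m + 1) := by
    rw [← pow_add, show j + (m + 1) = m + j + 1 by ring]
    simpa [pow_succ] using hrel
  exact Nat.eq_of_mul_eq_mul_right (pow_pos two_pos (m + 1)) hrel'

/-- **`[Γ_{ℚ₂} : Gal(ℚ̄₂/ℚ_{2,n})] = 2ⁿ`** (model `ℚ_[2]`, any `ι`): `[ℚ_{2,n}·ℚ₂ : ℚ₂] = 2ⁿ`, the prime `2` is totally ramified in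
`ℚ_n`. [cite: Washington1997, §13.1] [cite: Kobayashi2003, §2 p. 4] -/
theorem index_localLayerSubgroupOfEmb_two (hκ : κ.IsCyclotomic) (n : ℕ) : (localLayerSubgroupOfEmb κ ι n).index = 2 ^ n := by
  have h := index_subgroupOf_localLayerSubgroupOfEmb_two ι hκ (Nat.zero_le n)
  rw [localLayerSubgroupOfEmb_zero] at h
  change (localLayerSubgroupOfEmb κ ι n).relIndex ⊤ = _ at h
  rwa [Subgroup.relIndex_top_right, Nat.sub_zero] at h

end Trace

end Summit.BirchSwinnertonDyer.BirchSwinnertonDyer.Theorems.SignedEC.PlusLayer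

end
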